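import Mathlib
import Summits.KontsevichZagierPeriods.Zeta5Search.WedgeDictionaryWideSorting
import Summits.KontsevichZagierPeriods.Zeta5Search.WedgeDictionaryFullQ
import HarnessLib

/-!
# `wedgeDictionaryFull` holds: the wedge dictionary on the whole wide region (cell `pub-zeta5`, seat ct-1 g23)

HONEST FRAMING: systematic search; no irrationality claim unless certified.  An induction over landed relation theorems among
Brown–Zudilin's absolutely convergent cellular integrals `I(a)` (arXiv:2210.03391) and the cell's rational dictionary data; no new
value of any integral is computed (the base of the induction is the half box, where everything is a tree theorem), no `γ`, nothing
about `ζ(5)`; records in print UNMOVED; no `def`, no new node.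

typer g3's `@[conjecture] wedgeDictionaryFull` (the planners' Conjecture 2 VERBATIM: for every convergent `a` with `b(a) ≥ 0`,
`d(b(a)) ≥ 0` and ANY partner `j ∈ [1,7]`, `Q(a) = ρ(UW′ − U′W)` and
`I(a) = 2ρ·[(W(b′) − 2ζ(2)U(b′))·F̃₇(b) − (W(b) − 2ζ(2)U(b))·F̃₇(b′)]`, `b′ = b + e_j`) is PROVED:

* `explicitPQAt_wide` — gen-1's explicit form `I(a) = Q(a)θ − 4P̂_d(a)ζ(2) − 2P_d(a)` at EVERY wide point, by strong induction on
  the TOTAL EXCESS `φ(a) = Σ_i max(0, 2b_i − b₀ − 1)` (zero exactly on the half box, where ct-1 g22's `explicitPQAt_allPartners` is the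
  base): sort the slots by `Σ₇` (`exists_sorting`, `sorted_converges`, transport `explicitPQAt_slotPerm_wide_iff`), then the target
  `T` is the slot member of the typed BRIDGE cluster with base `c = T − e₇` (`explicitPQAt_bridgeSlot`: `cellBridge_wide` +
  `dictBridge_wide`, coefficient `−(N+1−t₃−t₇)(N+1−t₆−t₇) ≠ 0`), whose other three members `c`, `c + e₁ + e₃`, `c + DS` are wide
  points of strictly smaller total excess (scheme checked beforehand on all 15,326 wide points of levels `≤ 6`, `code/scheme_bridge_only.py`);
* **`wedgeDictionaryFull_holds : wedgeDictionaryFull`** — with ct-1 g22's `wedgeDictionaryFull_Q` and the canonical decomposition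
  `vwp_decomposition` at `b` and `b′` (as in `wedgeDictionary_allPartners`).
-/

noncomputable section

open Finset

namespace Summit.KontsevichZagierPeriods.Zeta5Search.WedgeDictionaryWideInduction

open Summit.KontsevichZagierPeriods.Zeta5Search.WedgeDictionary
open Summit.KontsevichZagierPeriods.Zeta5Search.DualSeries
open Summit.KontsevichZagierPeriods.Zeta5Search.WedgeDictionaryWideSteps (converges_iff_bcoords wide_add_slotDown
  explicitPQAt_bridgeSlot)
open Summit.KontsevichZagierPeriods.Zeta5Search.WedgeDictionaryWideSorting (exists_sorting sorted_converges)
open Summit.KontsevichZagierPeriods.Zeta5Search.ExplicitPQWideTransport (explicitPQAt_slotPerm_wide_iff wide_slotPerm)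
open Summit.KontsevichZagierPeriods.Zeta5Search.WedgeDictionaryAllPartners (explicitPQAt_allPartners)
open Summit.KontsevichZagierPeriods.Zeta5Search.WedgeDictionaryFullQ (wedgeDictionaryFull_Q)
open Summit.KontsevichZagierPeriods.Zeta5Search.CellStarPencilDischarge (bOfA_slotPerm)
open Summit.KontsevichZagierPeriods.Zeta5Search.SymmetricGauge (permLower permLower_apply_succ permLower_zero sum_range7_permLower)
open Literature.NumberTheory.Irrationality.BrownZudilin2022 (bOfA Converges QOf cellularIntegral slotPerm vwpDual)
open Literature.NumberTheory.Transcendental (zetaValue)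

/-! ## 1. The two measures are `Σ₇`-invariant -/

/-- The total excess is invariant under slot permutations. [folklore] -/
theorem sum_excess_slotPerm (σ : Equiv.Perm (Fin 7)) (a : Fin 8 → ℤ) :
    (∑ i ∈ range 7, max 0 (2 * bOfA (slotPerm σ a) (i + 1) - bOfA (slotPerm σ a) 0 - 1)) =
      ∑ i ∈ range 7, max 0 (2 * bOfA a (i + 1) - bOfA a 0 - 1) := by
  rw [bOfA_slotPerm, permLower_zero]
  exact sum_range7_permLower σ⁻¹ (bOfA a) (fun x => max 0 (2 * x - bOfA a 0 - 1))

/-! ## 2. The induction -/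

set_option maxHeartbeats 1600000 in
/-- **`ExplicitPQAt` on the whole wide region, by strong induction on the total excess** `φ(a) = Σ_i max(0, 2b_i − b₀ − 1)`. [folklore] -/
theorem explicitPQAt_wide_aux : ∀ (φ : ℕ) (a : Fin 8 → ℤ) (j : ℕ), j ∈ Icc 1 7 → Converges a → (∀ i ∈ Icc 1 7, 0 ≤ bOfA a i) →
    0 ≤ dOf (bOfA a) → (∑ i ∈ range 7, max 0 (2 * bOfA a (i + 1) - bOfA a 0 - 1)) ≤ (φ : ℤ) → ExplicitPQAt a j := by
  intro φ
  induction φ using Nat.strong_induction_on with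
  | _ φ IH =>
  intro a j hj hconv hnn hd hφ
  -- base: the half box
  by_cases hH : ∀ i ∈ Icc 1 7, 2 * bOfA a i ≤ bOfA a 0 + 1
  · exact explicitPQAt_allPartners hconv (fun i hi => ⟨hnn i hi, hH i hi⟩) hd hj
  -- sort the slots
  obtain ⟨σ, h17, h21, h62, h36, h43, h54⟩ := exists_sorting a
  obtain ⟨hconvT, P12, P67⟩ := sorted_converges hconv hnn σ h17 h21 h62 h36 h43 h54
  obtain ⟨hnnT, hdT⟩ := wide_slotPerm σ hnn hd
  refine (explicitPQAt_slotPerm_wide_iff σ hj hj hconv hnn hd hconvT).2 ?_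
  set T := slotPerm σ a with hT
  have hφT : (∑ i ∈ range 7, max 0 (2 * bOfA T (i + 1) - bOfA T 0 - 1)) ≤ (φ : ℤ) := by
    rw [hT, sum_excess_slotPerm]; exact hφ
  -- the maximal slot `7` is off the half box
  have hback : ∀ m : Fin 7, bOfA a (m.val + 1) = bOfA T ((σ m).val + 1) := fun m => by
    rw [hT, bOfA_slotPerm, permLower_apply_succ, Equiv.Perm.inv_def, Equiv.symm_apply_apply]
  have h0T : bOfA T 0 = bOfA a 0 := by rw [hT, bOfA_slotPerm, permLower_zero]
  have hle7 : ∀ n, 1 ≤ n → n ≤ 7 → bOfA T n ≤ bOfA T 7 := by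
    intro n h1 h7
    interval_cases n <;> omega
  have hbig : bOfA T 0 + 2 ≤ 2 * bOfA T 7 := by
    by_contra hc
    apply hH
    intro i hi
    obtain ⟨hi1, hi7⟩ := mem_Icc.1 hi
    obtain ⟨m, rfl⟩ : ∃ m : Fin 7, i = m.val + 1 := ⟨⟨i - 1, by omega⟩, by simp only; omega⟩
    rw [hback m, ← h0T]
    have := hle7 ((σ m).val + 1) (by omega) (by have := (σ m).isLt; omega)
    omega
  -- the coordinates of `T`, `c = T − e₇`, `X = c + e₁ + e₃`, `D = c + DS`
  obtain ⟨t2n, t3n, p12, p13, p14, p15, p23, p24, p25, p26, p34, p36, p37, p47, p56, p57, p67⟩ :=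
    (converges_iff_bcoords T).1 hconvT
  have n1 := hnnT 1 (by simp); have n4 := hnnT 4 (by simp); have n5 := hnnT 5 (by simp); have n6 := hnnT 6 (by simp)
  have hdT' := hdT
  unfold dOf at hdT'
  simp only [sum_range_succ, sum_range_zero, zero_add, Nat.reduceAdd] at hdT'
  have hc : ∀ n, n ≤ 7 → bOfA (T + slotDown 7) n = if n = 7 then bOfA T n - 1 else bOfA T n :=
    fun n hn => bOfA_add_slotDown T 7 (by simp) n hn
  have c0 := hc 0 (by norm_num); have c1 := hc 1 (by norm_num); have c2 := hc 2 (by norm_num); have c3 := hc 3 (by norm_num)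
  have c4 := hc 4 (by norm_num); have c5 := hc 5 (by norm_num); have c6 := hc 6 (by norm_num); have c7 := hc 7 (by norm_num)
  norm_num at c0 c1 c2 c3 c4 c5 c6 c7
  have hX : ∀ n, n ≤ 7 → bOfA (T + slotDown 7 + halfUp457) n =
      if n = 0 ∨ n = 4 ∨ n = 5 ∨ n = 7 then bOfA (T + slotDown 7) n + 1 else bOfA (T + slotDown 7) n :=
    fun n hn => bOfA_add_halfUp457 _ n hn
  have X0 := hX 0 (by norm_num); have X1 := hX 1 (by norm_num); have X2 := hX 2 (by norm_num); have X3 := hX 3 (by norm_num)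
  have X4 := hX 4 (by norm_num); have X5 := hX 5 (by norm_num); have X6 := hX 6 (by norm_num); have X7 := hX 7 (by norm_num)
  norm_num at X0 X1 X2 X3 X4 X5 X6 X7
  rw [c0] at X0; rw [c1] at X1; rw [c2] at X2; rw [c3] at X3; rw [c4] at X4; rw [c5] at X5; rw [c6] at X6; rw [c7] at X7
  have hD : ∀ n, n ≤ 7 → bOfA (T + slotDown 7 + dsUp) n =
      if n = 0 then bOfA (T + slotDown 7) 0 + 2 else bOfA (T + slotDown 7) n + 1 :=
    fun n hn => bOfA_add_dsUp _ n hn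
  have D0 := hD 0 (by norm_num); have D1 := hD 1 (by norm_num); have D2 := hD 2 (by norm_num); have D3 := hD 3 (by norm_num)
  have D4 := hD 4 (by norm_num); have D5 := hD 5 (by norm_num); have D6 := hD 6 (by norm_num); have D7 := hD 7 (by norm_num)
  norm_num at D0 D1 D2 D3 D4 D5 D6 D7
  rw [c0] at D0; rw [c1] at D1; rw [c2] at D2; rw [c3] at D3; rw [c4] at D4; rw [c5] at D5; rw [c6] at D6; rw [c7] at D7
  -- the three other members are wide
  obtain ⟨hcc, hnc, hdc⟩ := wide_add_slotDown (show 7 ∈ Icc 1 7 by simp) hconvT hnnT hdT (by omega)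
  have hcX : Converges (T + slotDown 7 + halfUp457) := by
    rw [converges_iff_bcoords, X0, X1, X2, X3, X4, X5, X6, X7]
    omega
  have hnX : ∀ m ∈ Icc 1 7, 0 ≤ bOfA (T + slotDown 7 + halfUp457) m := by
    intro m hm
    obtain ⟨hm1, hm7⟩ := mem_Icc.1 hm
    have := hnnT m hm
    interval_cases m <;> omega
  have hdX : 0 ≤ dOf (bOfA (T + slotDown 7 + halfUp457)) := by
    unfold dOf
    simp only [sum_range_succ, sum_range_zero, zero_add, Nat.reduceAdd]
    rw [X0, X1, X2, X3, X4, X5, X6, X7]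
    omega
  have hcD : Converges (T + slotDown 7 + dsUp) := by
    rw [converges_iff_bcoords, D0, D1, D2, D3, D4, D5, D6, D7]
    omega
  have hnD : ∀ m ∈ Icc 1 7, 0 ≤ bOfA (T + slotDown 7 + dsUp) m := by
    intro m hm
    obtain ⟨hm1, hm7⟩ := mem_Icc.1 hm
    have := hnnT m hm
    interval_cases m <;> omega
  have hdD : 0 ≤ dOf (bOfA (T + slotDown 7 + dsUp)) := by
    unfold dOf
    simp only [sum_range_succ, sum_range_zero, zero_add, Nat.reduceAdd]
    rw [D0, D1, D2, D3, D4, D5, D6, D7]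
    omega
  -- the BRIDGE side conditions
  have h16 : bOfA (T + slotDown 7) 1 + bOfA (T + slotDown 7) 6 ≤ bOfA (T + slotDown 7) 0 := by rw [c1, c6, c0]; omega
  have hβ : bridgeSlot (bOfA (T + slotDown 7)) ≠ 0 := by
    unfold bridgeSlot
    rw [c0, c3, c6, c7]
    have h1 : 0 < bOfA T 0 - bOfA T 3 - (bOfA T 7 - 1) := by omega
    have h2 : 0 < bOfA T 0 - bOfA T 6 - (bOfA T 7 - 1) := by omega
    have := mul_pos h1 h2
    omega
  -- the induction hypothesis at the three members: total excess at most `φ − 1`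
  have hφT' := hφT
  simp only [sum_range_succ, sum_range_zero, zero_add, Nat.reduceAdd] at hφT'
  have hφ1 : 1 ≤ φ := by
    have : (1 : ℤ) ≤ φ := by
      have : (0 : ℤ) ≤ max 0 (2 * bOfA T 1 - bOfA T 0 - 1) := le_max_left _ _
      have : (0 : ℤ) ≤ max 0 (2 * bOfA T 2 - bOfA T 0 - 1) := le_max_left _ _
      have : (0 : ℤ) ≤ max 0 (2 * bOfA T 3 - bOfA T 0 - 1) := le_max_left _ _
      have : (0 : ℤ) ≤ max 0 (2 * bOfA T 4 - bOfA T 0 - 1) := le_max_left _ _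
      have : (0 : ℤ) ≤ max 0 (2 * bOfA T 5 - bOfA T 0 - 1) := le_max_left _ _
      have : (0 : ℤ) ≤ max 0 (2 * bOfA T 6 - bOfA T 0 - 1) := le_max_left _ _
      have : (1 : ℤ) ≤ max 0 (2 * bOfA T 7 - bOfA T 0 - 1) := le_trans (by omega) (le_max_right _ _)
      omega
    exact_mod_cast this
  have hcast : (((φ - 1 : ℕ) : ℤ)) = (φ : ℤ) - 1 := by omega
  have Ec : ExplicitPQAt (T + slotDown 7) j := by
    refine IH (φ - 1) (by omega) _ j hj hcc hnc hdc ?_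
    simp only [sum_range_succ, sum_range_zero, zero_add, Nat.reduceAdd]
    rw [c0, c1, c2, c3, c4, c5, c6, c7, hcast]
    omega
  have EX : ExplicitPQAt (T + slotDown 7 + halfUp457) j := by
    refine IH (φ - 1) (by omega) _ j hj hcX hnX hdX ?_
    simp only [sum_range_succ, sum_range_zero, zero_add, Nat.reduceAdd]
    rw [X0, X1, X2, X3, X4, X5, X6, X7, hcast]
    omega
  have ED : ExplicitPQAt (T + slotDown 7 + dsUp) j := by
    refine IH (φ - 1) (by omega) _ j hj hcD hnD hdD ?_
    simp only [sum_range_succ, sum_range_zero, zero_add, Nat.reduceAdd]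
    rw [D0, D1, D2, D3, D4, D5, D6, D7, hcast]
    omega
  exact explicitPQAt_bridgeSlot hj hj hj hj hconvT hnnT hdT hcc hnc hdc hcX hnX hdX hcD hnD hdD h16 hβ Ec EX ED

/-- **gen-1's dictionary in explicit form on the WHOLE WIDE REGION**: for every convergent `a` with `b(a) ≥ 0`, `d ≥ 0` and every
partner `j ∈ [1,7]`, `I(a) = Q(a)(2ζ(5) + 4ζ(3)ζ(2)) − 4P̂_d(a)ζ(2) − 2P_d(a)`. [folklore] -/
theorem explicitPQAt_wide {a : Fin 8 → ℤ} {j : ℕ} (hj : j ∈ Icc 1 7) (hconv : Converges a)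
    (hnn : ∀ i ∈ Icc 1 7, 0 ≤ bOfA a i) (hd : 0 ≤ dOf (bOfA a)) : ExplicitPQAt a j :=
  explicitPQAt_wide_aux _ a j hj hconv hnn hd (Int.self_le_toNat _)

/-! ## 3. Conjecture 2 -/

/-- **The planners' Conjecture 2 holds: `wedgeDictionaryFull`** — for every convergent `a` with `b(a) ≥ 0`, `d(b(a)) ≥ 0` and every
partner `j ∈ [1,7]`: `Q(a) = ρ(a)·(U(b)W(b′) − U(b′)W(b))` and
`I(a) = 2ρ(a)·[(W(b′) − 2ζ(2)U(b′))·F̃₇(b) − (W(b) − 2ζ(2)U(b))·F̃₇(b′)]`, `b = b(a)`, `b′ = b + e_j`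
(`wedgeDictionaryFull_Q` + `explicitPQAt_wide` + the canonical decomposition at `b`, `b′`). [folklore] -/
theorem wedgeDictionaryFull_holds : wedgeDictionaryFull := by
  intro a j hj hconv hnn hd
  have hQ := wedgeDictionaryFull_Q hconv hnn hd hj
  refine ⟨hQ, ?_⟩
  have hI := explicitPQAt_wide hj hconv hnn hd
  unfold ExplicitPQAt dictPhat dictP at hI
  obtain ⟨hbox, hle⟩ := inBox_of_full a hconv hnn
  obtain ⟨i, rfl⟩ : ∃ i, j = i + 1 := ⟨j - 1, by have := (mem_Icc.1 hj).1; omega⟩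
  have hi : i ∈ range 7 := by have := (mem_Icc.1 hj).2; exact mem_range.2 (by omega)
  obtain ⟨hbox', hsum'⟩ := box_update (bOfA a) hbox hd hi (hle _ hj)
  have h1 := (vwp_decomposition (bOfA a) hbox (sum_le_of_dOf (bOfA a) hd)).2
  have h2 := (vwp_decomposition _ hbox' hsum').2
  have hQ' : ((QOf a : ℤ) : ℝ) = (rhoOf a : ℝ) * ((coeffU (bOfA a) : ℝ) *
      coeffW (Function.update (bOfA a) (i + 1) (bOfA a (i + 1) + 1)) -
        coeffU (Function.update (bOfA a) (i + 1) (bOfA a (i + 1) + 1)) * coeffW (bOfA a)) := by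
    have h := congrArg (fun q : ℚ => (q : ℝ)) hQ
    push_cast at h
    exact h
  rw [hI, h1, h2]
  push_cast
  rw [hQ']
  ring

end Summit.KontsevichZagierPeriods.Zeta5Search.WedgeDictionaryWideInduction

end
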